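import Literature.NumberTheory.EllipticCurves.GreenbergSelmerOrdinaryFiltrationProofs
import Literature.NumberTheory.EllipticCurves.GreenbergSelmerNewformDatum
import Literature.NumberTheory.Automorphic.PadicPlaceCoefficientRing
import Literature.NumberTheory.GaloisRepresentations.PadicAlgClFiniteSubextensionDvr
import HarnessLib

/-!
# The integral ordinary datum `(ρ_f, A'_f, π)` of an ordinary `Γ₀(M)`-newform EXISTS, granted
# Deligne's theorem and Hida's Thm. 3.26 (2) (proofs only)

A theorems-only companion (no definition, no named fact; D-0026) of
`GreenbergSelmerNewformDatum.lean` (the hypothesis structure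
`GreenbergSelmer.OrdinaryNewformDatum g p ι`: an integral model `ρ : Γ_ℚ → GL₂(𝒪)` of the
`p`-adically embedded newform `(g, ι)` over `𝒪 = padicCoeffIntegers ι = {x ∈ ℚ_p(ι K_g) : |x|_p ≤ 1}`,
attached to `(g, ι)` away from `M p`, an `OrdinaryFiltration ρ v` at the places above `p`, and a
uniformiser `π` — Emerton–Pollack–Weston, Invent. Math. 163 (2006), §3.1, p. 17: "`K` the finite
extension of `ℚ_p` generated by the Fourier coefficients of `f` and `𝒪` the ring of integers of
`K` … fix also a uniformizer `π` of `𝒪` … there is a unique integral model `ρ_f : G_ℚ → GL₂(𝒪)` …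
We obtain from (eq:ordes) and [Gross] an `𝒪[G_p]`-equivariant exact sequence
`0 → A'_f → A_f → A''_f → 0`").  Its existence is Hida, *Modular Forms and Galois Cohomology*
(2000), Thm. 3.26 (1) (Shimura, Deligne, Serre) + (2) (Deligne, Mazur–Wiles; Wiles 1988, Thm. 2.1.4),
which the cell's literature seat typed as the named fact
`Hida2000_thm326_nonempty_ordinaryNewformDatum` (file `OrdinaryNewformDatumExists.lean`, in
review at the time of writing).  THIS FILE PROVES that statement from the tree's two standing named
facts — Deligne's theorem at the finite places of the coefficient field
(`ModularForms.DeligneSerre1974.thm61_exists_adicGaloisRep`) and the `ℚ̄_p`-form of Hida's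
Thm. 3.26 (2) (`Hida2000_thm326_ordinary`) — so that the datum binder `hΔ` of the X11a chain of the
BSD residual cell (`Summits/BirchSwinnertonDyer/Rank1Residual/X11a/ChainSocket.lean`; glue validated
by the literature seat) is discharged by those two facts and adds no independent input:

* `exists_framedGaloisRep_adicCompletionIntegers_integralFrame` — granted both facts: a continuous
  `ρ_v : Γ_ℚ → GL₂(𝒪_v)` over the integers of `(K₁)_v` (`K₁ = ℚ(a_n, ε)` of the `Γ₁`-newform,
  `v ∋ p` with `v(a_p) = 1`) whose base change to `(K₁)_v` is attached to the form, together with an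
  INTEGRAL ordinary frame `Q₀ ∈ GL₂(𝒪_v)` at every place `w ∋ p` (Deligne + Serre's stable lattice +
  the tree's descent `Hida2000_thm326_ordinary.exists_frame_adicCompletion` + Wiles's lattice step
  `exists_integralFrame_of_frame`).
* `integralFrame_baseChange`, `isUnramifiedAt_baseChange`, `isUnramifiedAt_of_baseChange_injective`,
  `map_charpoly_baseChange_eq` — transport of frames, unramifiedness and Frobenius polynomials along
  a change of integral coefficients `e : 𝒪_v → 𝒪` (pure algebra).
* `nonempty_ordinaryNewformDatum_of_thm61_of_thm326` — for a newform `g ∈ S_k(Γ₀(M))`, `k ≥ 2`,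
  `p ∤ M`, `ι : K_g → ℚ̄_p` with `|ι(a_p(g))|_p = 1`: `Nonempty (OrdinaryNewformDatum g p ι)`.  The
  transport `e : 𝒪_v → 𝒪` is the tree's continuous extension `φ_j : (K₁)_v → ℚ̄_p` of
  `j = ι|_{K₁}` (`ParallelWeight.padicPlaceHom`; Neukirch II §8), which lands in `K = ℚ_p(ι K_g)`
  (closed: finite-dimensional, `ParallelWeight.isClosed_intermediateField`) and is integral on
  `𝒪_v` (`ParallelWeight.valued_padicPlaceHom_le_one`); the uniformiser comes from the tree's
  `PadicAlgCl.isDiscreteValuationRing_unitBall` (Serre, *Local Fields* II §2 Prop. 3).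

Net debt: 0 (no `def … : Prop`); the two deep inputs enter as hypotheses by name.

## References

* H. Hida, *Modular Forms and Galois Cohomology*, CUP (2000), Thm. 3.26 (1)–(2), pp. 151–152.
  [Hida2000]
* M. Emerton, R. Pollack, T. Weston, *Variation of Iwasawa invariants in Hida families*, Invent.
  Math. 163 (2006), §3.1 (p. 17). [EmertonPollackWeston2006]
* A. Wiles, *On ordinary `λ`-adic representations associated to modular forms*, Invent. Math. 94
  (1988), Thm. 2.1.4 (p. 561), pp. 562–563. [Wiles1988]
* P. Deligne, J.-P. Serre, *Formes modulaires de poids 1*, Ann. Sci. ÉNS 7 (1974), Thm. 6.1.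
  [DeligneSerreASENS1974]
* J.-P. Serre, *Abelian ℓ-adic representations and elliptic curves* (1968), Ch. I §1.1 (stable
  lattices); *Local Fields* (1979), Ch. II §2, Prop. 3. [SerreAbelianLadic1968] [SerreLocalFields1979]
* J. Neukirch, *Algebraic Number Theory* (1999), Ch. II §8 (pp. 160–161). [NeukirchANT1999]
-/

noncomputable section

open scoped MatrixGroups Matrix ModularForm NumberField

open NumberField IsDedekindDomain Field CongruenceSubgroup UpperHalfPlane Rat.HeightOneSpectrum
  Polynomial
open Literature.NumberTheory.GaloisRepresentations
open Literature.NumberTheory.EllipticCurves.ModularForms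

namespace Literature.NumberTheory.EllipticCurves.GreenbergSelmer

/-! ## §1. Transport along a change of integral coefficients (pure algebra) -/

section Transport

variable {K : Type} [Field K]
variable {O S : Type} [CommRing O] [TopologicalSpace O] [CommRing S] [TopologicalSpace S]

/-- An integral ordinary frame `Q₀` of `ρ|_{Γ_{K_v}}` (upper triangular, lower-right entry `1` on
inertia) gives the integral ordinary frame `e(Q₀)` of `ρ ⊗_e S`: `e` is a ring homomorphism, so
`e(Q₀)⁻¹ (e ρ) e(Q₀) = e(Q₀⁻¹ ρ Q₀)` entrywise.  (Greenberg 1989, (1): the filtration read on a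
basis; change of the coefficient ring.) [cite: Greenberg1989, §1 p. 98 (1)] -/
theorem integralFrame_baseChange [NumberField K] (e : O →+* S) (he : Continuous e)
    (ρ : FramedGaloisRep K O 2)
    (v : HeightOneSpectrum (𝓞 K)) (Q₀ : GL (Fin 2) O)
    (h10 : ∀ σ : absoluteGaloisGroup (v.adicCompletion K), (Q₀⁻¹ * ρ.toLocal v σ * Q₀).val 1 0 = 0)
    (h11 : ∀ σ ∈ absInertia (v.adicCompletion K), (Q₀⁻¹ * ρ.toLocal v σ * Q₀).val 1 1 = 1)
    (σ : absoluteGaloisGroup (v.adicCompletion K)) :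
    ((Matrix.GeneralLinearGroup.map e Q₀)⁻¹ *
        FramedGaloisRep.toLocal v (FramedRep.baseChange e he ρ) σ *
        Matrix.GeneralLinearGroup.map e Q₀).val 1 0 = 0 ∧
    (σ ∈ absInertia (v.adicCompletion K) →
      ((Matrix.GeneralLinearGroup.map e Q₀)⁻¹ *
        FramedGaloisRep.toLocal v (FramedRep.baseChange e he ρ) σ *
        Matrix.GeneralLinearGroup.map e Q₀).val 1 1 = 1) := by
  have hmap : (Matrix.GeneralLinearGroup.map e Q₀)⁻¹ *
      FramedGaloisRep.toLocal v (FramedRep.baseChange e he ρ) σ * Matrix.GeneralLinearGroup.map e Q₀ =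
      Matrix.GeneralLinearGroup.map e (Q₀⁻¹ * ρ.toLocal v σ * Q₀) := by
    rw [map_mul, map_mul, map_inv]
    rfl
  refine ⟨?_, fun hσ ↦ ?_⟩
  · rw [hmap]
    change e ((Q₀⁻¹ * ρ.toLocal v σ * Q₀).val 1 0) = 0
    rw [h10 σ, map_zero]
  · rw [hmap]
    change e ((Q₀⁻¹ * ρ.toLocal v σ * Q₀).val 1 1) = 1
    rw [h11 σ hσ, map_one]

/-- Unramifiedness ascends along a change of coefficients: `ρ(σ) = 1 ⇒ e(ρ(σ)) = 1`.
[cite: SerreAbelianLadic1968, Ch. I §2.1] -/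
theorem isUnramifiedAt_baseChange (e : O →+* S) (he : Continuous e) {ρ : FramedGaloisRep K O 2}
    {v : HeightOneSpectrum (𝓞 K)} (h : ρ.IsUnramifiedAt v) :
    FramedGaloisRep.IsUnramifiedAt v (FramedRep.baseChange e he ρ) := by
  intro 𝔓 h𝔓 σ hσ
  rw [FramedRep.baseChange_apply, h 𝔓 h𝔓 σ hσ, map_one]

/-- Unramifiedness descends along an INJECTIVE change of coefficients: `e(ρ(σ)) = 1 ⇒ ρ(σ) = 1`.
[cite: SerreAbelianLadic1968, Ch. I §2.1] -/
theorem isUnramifiedAt_of_baseChange_injective (e : O →+* S) (he : Continuous e)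
    (hinj : Function.Injective e) {ρ : FramedGaloisRep K O 2} {v : HeightOneSpectrum (𝓞 K)}
    (h : FramedGaloisRep.IsUnramifiedAt v (FramedRep.baseChange e he ρ)) :
    ρ.IsUnramifiedAt v := by
  intro 𝔓 h𝔓 σ hσ
  have h1 := h 𝔓 h𝔓 σ hσ
  rw [FramedRep.baseChange_apply] at h1
  apply Units.ext
  apply Matrix.map_injective hinj
  have h2 := congrArg (fun g : GL (Fin 2) S ↦ (g : Matrix (Fin 2) (Fin 2) S)) h1
  simpa [Matrix.map_one] using h2

/-- The Frobenius characteristic polynomials of two base changes `ρ ⊗_e S`, `ρ ⊗_f F` agree in a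
common over-ring `B` when the square `t ∘ e = φ ∘ f` commutes: conjugation-free bookkeeping
(`charpoly` commutes with `map`, Mathlib `Matrix.charpoly_map`).
[cite: SerreAbelianLadic1968, Ch. I §2.3] -/
theorem map_charpoly_baseChange_eq {F B : Type*} [CommRing F] [TopologicalSpace F] [CommRing B]
    (e : O →+* S) (he : Continuous e) (f : O →+* F) (hf : Continuous f) (t : S →+* B) (φ : F →+* B)
    (hsq : ∀ x, t (e x) = φ (f x)) (ρ : FramedGaloisRep K O 2) (σ : absoluteGaloisGroup K) :
    (FramedRep.charpoly (FramedRep.baseChange e he ρ) σ).map t =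
      (FramedRep.charpoly (FramedRep.baseChange f hf ρ) σ).map φ := by
  simp only [FramedRep.charpoly, FramedRep.baseChange_apply]
  change (((ρ σ : GL (Fin 2) O) : Matrix (Fin 2) (Fin 2) O).map e).charpoly.map t =
    (((ρ σ : GL (Fin 2) O) : Matrix (Fin 2) (Fin 2) O).map f).charpoly.map φ
  rw [← Matrix.charpoly_map, ← Matrix.charpoly_map, Matrix.map_map, Matrix.map_map]
  congr 2
  funext x
  exact hsq x

end Transport

/-! ## §2. The `λ`-adic integral model with integral ordinary frames -/

section Adic

variable {N : ℕ} [NeZero N] {k : ℤ}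

/-- **Granted Deligne's theorem and Hida's Thm. 3.26 (2): an integral `λ`-adic model with integral
ordinary frames.**  For a newform `g ∈ S_k(Γ₁(N))`, `k ≥ 2`, a place `v` of `K_g` above `p ∤ N`
with `v(a_p(g)) = 1`: a continuous `ρ : Γ_ℚ → GL₂(𝒪_v)` whose base change to `(K_g)_v` is
attached to `g` through `K_g → (K_g)_v` away from `N p`, and, at every place `w ∋ p` of `ℚ`, an
integral frame `Q₀ ∈ GL₂(𝒪_v)` in which `ρ|_{Γ_{ℚ_w}}` is upper triangular with lower-right entry
`1` on inertia.  (Deligne's `ρ_v`; Serre's stable lattice `exists_integralModel_of_valuationSubring`;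
the `(K_g)_v`-rational frame `Hida2000_thm326_ordinary.exists_frame_adicCompletion`; Wiles's
lattice step `exists_integralFrame_of_frame`.) [cite: Hida2000, Thm. 3.26 (1)–(2), pp. 151–152]
[cite: Wiles1988, Thm. 2.1.4 (p. 561), pp. 562–563] [cite: SerreAbelianLadic1968, Ch. I §1.1, Remark 1] -/
theorem exists_framedGaloisRep_adicCompletionIntegers_integralFrame
    (h61 : DeligneSerre1974.thm61_exists_adicGaloisRep) (h : Hida2000_thm326_ordinary)
    {g : CuspForm (Gamma1 N) k} (hk : 2 ≤ k) (hg : IsNewform1 g) [NumberField (coeffCharField g)]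
    (v : HeightOneSpectrum (𝓞 (coeffCharField g))) {p : ℕ} (hp : p.Prime)
    (hpv : ((p : ℕ) : 𝓞 (coeffCharField g)) ∈ v.asIdeal) (hpN : ¬ p ∣ N)
    (hord : v.valuation (coeffCharField g)
      ⟨(qExpansion 1 ⇑g).coeff p, cuspCoeff_mem_coeffCharField g p⟩ = 1) :
    ∃ ρ : FramedGaloisRep ℚ (v.adicCompletionIntegers (coeffCharField g)) 2,
      IsGaloisRepOfNewform1 g
        (algebraMap (coeffCharField g) (v.adicCompletion (coeffCharField g))) {q | q ∣ N * p}
        (FramedRep.baseChange (v.adicCompletionIntegers (coeffCharField g)).subtype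
          continuous_subtype_val ρ) ∧
      ∀ {w : HeightOneSpectrum (𝓞 ℚ)}, (p : 𝓞 ℚ) ∈ w.asIdeal →
        ∃ Q₀ : GL (Fin 2) (v.adicCompletionIntegers (coeffCharField g)),
          ∀ σ : absoluteGaloisGroup (w.adicCompletion ℚ),
            (Q₀⁻¹ * ρ.toLocal w σ * Q₀).val 1 0 = 0 ∧
            (σ ∈ absInertia (w.adicCompletion ℚ) → (Q₀⁻¹ * ρ.toLocal w σ * Q₀).val 1 1 = 1) := by
  set F := v.adicCompletion (coeffCharField g) with hF
  set O : ValuationSubring F := v.adicCompletionIntegers (coeffCharField g) with hO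
  -- Deligne's representation over `(K_g)_v`
  obtain ⟨ρF, hρF⟩ :=
    DeligneSerre1974.thm61_exists_adicGaloisRep_iff_newformPlaces.mp h61 hk hg v p hp hpv
  -- a stable lattice
  have hOopen : IsOpen (O : Set F) := Valued.isOpen_valuationSubring F
  obtain ⟨P, ρ₀, hρ₀⟩ := exists_integralModel_of_valuationSubring (O := O) hOopen ρF
  have hcont : Continuous ρ₀ := by
    have hind : Topology.IsInducing (Matrix.GeneralLinearGroup.map (n := Fin 2) O.subtype) :=
      (Topology.IsInducing.subtypeVal : Topology.IsInducing (O.subtype : O → F)).generalLinearGroup_map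
    rw [hind.continuous_iff]
    have h1 : (Matrix.GeneralLinearGroup.map O.subtype ∘ ρ₀) = fun σ ↦ P⁻¹ * ρF σ * P :=
      funext fun σ ↦ hρ₀ σ
    rw [h1]
    exact (continuous_const.mul (map_continuous ρF)).mul continuous_const
  let ρ : FramedGaloisRep ℚ O 2 := ⟨ρ₀, hcont⟩
  have hbc : FramedRep.baseChange O.subtype continuous_subtype_val ρ = FramedRep.conj P⁻¹ ρF := by
    refine ContinuousMonoidHom.ext fun σ ↦ ?_
    rw [FramedRep.baseChange_apply, FramedRep.conj_apply, inv_inv]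
    exact hρ₀ σ
  have hρ : IsGaloisRepOfNewform1 g (algebraMap (coeffCharField g) F) {q | q ∣ N * p}
      (FramedRep.baseChange O.subtype continuous_subtype_val ρ) := by
    rw [hbc]
    exact isGaloisRepOfNewform1_conj P⁻¹ hρF
  refine ⟨ρ, hρ, fun {w} hw ↦ ?_⟩
  -- at `w ∋ p`: the `(K_g)_v`-rational frame, then an integral one with the same diagonal
  obtain ⟨Q, hQ⟩ := h.exists_frame_adicCompletion hk hg v hp hpv hpN hord hw hρ
  obtain ⟨Q₀, hQ₀⟩ := exists_integralFrame_of_frame (fun σ ↦ ρ.toLocal w σ) Q (fun σ ↦ (hQ σ).1)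
  refine ⟨Q₀, fun σ ↦ ⟨(hQ₀ σ).1, fun hσ ↦ ?_⟩⟩
  have h1 : (((Q₀⁻¹ * ρ.toLocal w σ * Q₀).val 1 1 : O) : F) = 1 := by
    rw [(hQ₀ σ).2.2]
    exact (hQ σ).2 hσ
  exact Subtype.ext h1

end Adic

/-! ## §3. `Γ₀(M)`-newforms with a `p`-adic embedding: the datum over `𝒪 = {x ∈ ℚ_p(ι K_g) : |x| ≤ 1}` -/

section GammaZero

variable {M : ℕ} [NeZero M] {k : ℤ}

/-- For a newform on `Γ₁(N)` with trivial nebentypus (e.g. the lift of a `Γ₀(N)`-newform) and a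
prime `ℓ` coprime to the level, the Hecke polynomial at `ℓ` is `X² − a_ℓ X + ℓ^{k−1}`; mapped along
a ring homomorphism `j : K_f → B` with `k ≥ 1` it reads `X² − C(j a_ℓ) X + C(ℓ^{(k−1)})` with a
natural-number exponent. [cite: DeligneSerreASENS1974, Thm. 6.1, (6.1.1) (p. 520)] -/
theorem map_heckePolynomial_of_nebentypus_eq_one {N : ℕ} [NeZero N] {f : CuspForm (Gamma1 N) k}
    (hε : nebentypus f = 1) (hk : 1 ≤ k) {ℓ : ℕ} (hℓ : (ℓ : ℕ).Coprime N) {B : Type*} [CommRing B]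
    (j : coeffCharField f →+* B) :
    (heckePolynomial f ℓ).map j =
      X ^ 2 - C (j ⟨(qExpansion 1 ⇑f).coeff ℓ, cuspCoeff_mem_coeffCharField f ℓ⟩) * X +
        C ((ℓ : B) ^ (k - 1).toNat) := by
  have hunit : IsUnit ((ℓ : ℕ) : ZMod N) := (ZMod.isUnit_iff_coprime ℓ N).mpr hℓ
  have hk' : ((k - 1).toNat : ℤ) = k - 1 := Int.toNat_of_nonneg (by omega)
  have hconst : (⟨(nebentypus f (ℓ : ZMod N) : ℂ) * (ℓ : ℂ) ^ (k - 1),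
      nebentypus_mul_zpow_mem_coeffCharField f ℓ⟩ : coeffCharField f) =
      ((ℓ : coeffCharField f)) ^ (k - 1).toNat := by
    apply Subtype.ext
    change (nebentypus f (ℓ : ZMod N) : ℂ) * (ℓ : ℂ) ^ (k - 1) =
      (((ℓ : coeffCharField f) ^ (k - 1).toNat : coeffCharField f) : ℂ)
    rw [hε, MulChar.one_apply hunit, one_mul]
    conv_lhs => rw [← hk', zpow_natCast]
    push_cast
    rfl
  rw [ModularForms.heckePolynomial, hconst, Polynomial.map_add, Polynomial.map_sub,
    Polynomial.map_mul, Polynomial.map_pow, Polynomial.map_X, Polynomial.map_C, Polynomial.map_C,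
    map_pow j, map_natCast j]

/-- **The integral ordinary datum of an ordinary `Γ₀(M)`-newform exists, granted Deligne's theorem
and Hida's Thm. 3.26 (2)** — Hida, *MFG* Thm. 3.26 (1)+(2) read as
`Nonempty (OrdinaryNewformDatum g p ι)` (the statement the cell's literature seat typed as the named
fact `Hida2000_thm326_nonempty_ordinaryNewformDatum`), PROVED from
`DeligneSerre1974.thm61_exists_adicGaloisRep` and `Hida2000_thm326_ordinary`.  For a newform
`g ∈ S_k(Γ₀(M))`, `k ≥ 2`, a prime `p ∤ M`, and `ι : K_g → ℚ̄_p` with `|ι(a_p(g))|_p = 1`: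
(i) `g₁ = liftToGamma1 g` is a `Γ₁(M)`-newform with the same `q`-expansion and trivial character,
`K₁ = ℚ(a_n, ε) ⊆ K_g` (`coeffCharField_liftToGamma1_le`) is a number field, and `j := ι|_{K₁}`
cuts out a place `v ∋ p` with `v(a_p) = 1` (`ParallelWeight.padicPlace`, Neukirch II (8.1));
(ii) §2 gives `ρ_v : Γ_ℚ → GL₂(𝒪_v)` attached to `g₁` with integral ordinary frames at `w ∋ p`;
(iii) the continuous extension `φ_j : (K₁)_v → ℚ̄_p` of `j` (`ParallelWeight.padicPlaceHom`) takes
values in `K = ℚ_p(ι K_g)` (closed, being finite-dimensional over `ℚ_p` — `K_g` is a number field by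
Deligne–Serre (2.7.3), proved in the tree — `padicPlaceHom_mem_of_forall_mem`) and maps `𝒪_v` into
`𝒪 = {|x| ≤ 1}` (`valued_padicPlaceHom_le_one`), giving a continuous `e : 𝒪_v → 𝒪` and
`ρ := ρ_v ⊗_e 𝒪`; (iv) `ρ` is attached to `(g, ι)`: unramified at `ℓ ∤ Mp` (transport both ways
along `e` and `𝒪_v ⊆ (K₁)_v`), and for an arithmetic Frobenius `σ` at `ℓ` the polynomial
`P := charpoly ρ(σ) ∈ 𝒪[X]` maps to `(X² − a_ℓX + ℓ^{k−1})` under `𝒪 → ℚ̄_p`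
(`map_charpoly_baseChange_eq` with `φ_j ∘ (K₁ → (K₁)_v) = j`), hence is the same for every Frobenius
(`𝒪 → ℚ̄_p` is injective); (v) the frames transport (`integralFrame_baseChange`) and give the
filtrations (`OrdinaryFiltration.exists_ofIntegralFrame`); (vi) a uniformiser: `𝒪` has the same
elements as the valuation ring of `K`, a discrete valuation ring
(`PadicAlgCl.isDiscreteValuationRing_unitBall`, Serre *Local Fields* II §2 Prop. 3), whose maximal
ideal `{|x| < 1}` (`PadicAlgCl.mem_maximalIdeal_unitBall_iff`) is principal.
[cite: Hida2000, Thm. 3.26 (1)–(2), pp. 151–152] [cite: EmertonPollackWeston2006, §3.1 (p. 17)]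
[cite: Wiles1988, Thm. 2.1.4 (p. 561), pp. 562–563] [cite: NeukirchANT1999, Ch. II §8 (pp. 160–161)]
[cite: SerreLocalFields1979, Ch. II §2, Prop. 3] -/
theorem nonempty_ordinaryNewformDatum_of_thm61_of_thm326
    (h61 : DeligneSerre1974.thm61_exists_adicGaloisRep) (h : Hida2000_thm326_ordinary)
    (g : CuspForm (Gamma0 M) k) (hg : IsNewform0 g) (hk : 2 ≤ k) (p : ℕ) [Fact p.Prime]
    (hpM : ¬ p ∣ M) (ι : coeffField g →+* PadicAlgCl p)
    (hord : ‖ι ⟨(qExpansion 1 ⇑g).coeff p, coeff_mem_coeffField g p⟩‖ = 1) :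
    Nonempty (OrdinaryNewformDatum g p ι) := by
  classical
  have hp : p.Prime := Fact.out
  /- (i) the `Γ₁`-lift, its coefficient field `K₁`, `j = ι|_{K₁}` -/
  have hg1 : IsNewform1 (liftToGamma1 M k g) := (isNewform1_liftToGamma1_iff_holds M k g).mpr hg
  have hg0 : g ≠ 0 := by
    intro h0
    have h1 : IsNormalized g := hg.2.2
    rw [IsNormalized, h0] at h1
    simp [UpperHalfPlane.qExpansion_zero] at h1
  have hcoe : (⇑(liftToGamma1 M k g) : ℍ → ℂ) = ⇑g := coe_liftToGamma1_holds M k g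
  have hε : nebentypus (liftToGamma1 M k g) = 1 := nebentypus_liftToGamma1_holds M k hg0
  haveI : NumberField (coeffCharField (liftToGamma1 M k g)) :=
    numberField_coeffCharField_liftToGamma1 hg
  have hle : coeffCharField (liftToGamma1 M k g) ≤ coeffField g := coeffCharField_liftToGamma1_le hg0
  set j : coeffCharField (liftToGamma1 M k g) →+* PadicAlgCl p :=
    ι.comp (IntermediateField.inclusion hle).toRingHom with hj
  have hjval : ∀ x : coeffCharField (liftToGamma1 M k g),
      j x = ι (IntermediateField.inclusion hle x) := fun x ↦ rfl
  have hjn : ∀ n : ℕ,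
      j ⟨(qExpansion 1 ⇑(liftToGamma1 M k g)).coeff n,
        cuspCoeff_mem_coeffCharField (liftToGamma1 M k g) n⟩ =
      ι ⟨(qExpansion 1 ⇑g).coeff n, coeff_mem_coeffField g n⟩ := by
    intro n
    have hval : (((IntermediateField.inclusion hle)
        ⟨(qExpansion 1 ⇑(liftToGamma1 M k g)).coeff n,
          cuspCoeff_mem_coeffCharField (liftToGamma1 M k g) n⟩ : coeffField g) : ℂ) =
        (qExpansion 1 ⇑g).coeff n := by
      rw [IntermediateField.coe_inclusion]
      change (qExpansion 1 ⇑(liftToGamma1 M k g)).coeff n = (qExpansion 1 ⇑g).coeff n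
      rw [hcoe]
    rw [hjval]
    exact congrArg ι (Subtype.ext hval)
  /- the place `v = v(j)` and `φ = φ_j` -/
  set v : HeightOneSpectrum (𝓞 (coeffCharField (liftToGamma1 M k g))) :=
    Automorphic.ParallelWeight.padicPlace (coeffCharField (liftToGamma1 M k g)) p j with hv
  have hpv : ((p : ℕ) : 𝓞 (coeffCharField (liftToGamma1 M k g))) ∈ v.asIdeal :=
    Automorphic.ParallelWeight.natCast_mem_padicPlace _ p j
  have hjv : ∀ r : 𝓞 (coeffCharField (liftToGamma1 M k g)), Valued.v (j r) < 1 ↔ r ∈ v.asIdeal :=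
    Automorphic.ParallelWeight.valued_lt_one_iff_mem_padicPlace _ p j
  set φ := Automorphic.ParallelWeight.padicPlaceHom (coeffCharField (liftToGamma1 M k g)) p j with hφ
  have hφc : Continuous φ := Automorphic.ParallelWeight.continuous_padicPlaceHom _ p j
  have hφj : ∀ x, φ (algebraMap _ _ x) = j x := Automorphic.ParallelWeight.padicPlaceHom_algebraMap _ p j
  -- `v(a_p) = 1`
  have hval1 : Valued.v (j ⟨(qExpansion 1 ⇑(liftToGamma1 M k g)).coeff p,
      cuspCoeff_mem_coeffCharField (liftToGamma1 M k g) p⟩) = 1 := by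
    rw [hjn p, PadicAlgCl.valuation_def, ← NNReal.coe_inj, coe_nnnorm, NNReal.coe_one]
    exact hord
  have hordv : v.valuation (coeffCharField (liftToGamma1 M k g))
      ⟨(qExpansion 1 ⇑(liftToGamma1 M k g)).coeff p,
        cuspCoeff_mem_coeffCharField (liftToGamma1 M k g) p⟩ = 1 :=
    (valued_eq_one_iff_valuation_eq_one j v hpv hjv _).mp hval1
  /- (ii) the `λ`-adic integral model with integral ordinary frames -/
  obtain ⟨ρv, hρv, hframe⟩ :=
    exists_framedGaloisRep_adicCompletionIntegers_integralFrame h61 h hk hg1 v hp hpv hpM hordv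
  /- (iii) `K = ℚ_p(ι K_g)` is finite-dimensional, hence closed; `φ` lands in `K` and is integral -/
  haveI hfdKg : FiniteDimensional ℚ (coeffField g) := by
    have h1 : FiniteDimensional ℚ (coeffField (liftToGamma1 M k g)) :=
      (IsNewform1.finiteDimensional_coeffField_of_span_integralLattice1
        (DeligneSerre1974_span_integralLattice1_holds M k)) hg1
    have h2 : coeffField (liftToGamma1 M k g) = coeffField g := by
      unfold coeffField
      rw [hcoe]
    rwa [h2] at h1
  haveI : NumberField (coeffField g) := NumberField.mk
  obtain ⟨L, hLfd, hιL⟩ := exists_intermediateField_finiteDimensional_range_subset ι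
  haveI := hLfd
  have hKL : padicCoeffField ι ≤ L :=
    IntermediateField.adjoin_le_iff.mpr (Set.range_subset_iff.mpr hιL)
  haveI hfdK : FiniteDimensional ℚ_[p] (padicCoeffField ι) :=
    FiniteDimensional.of_injective (IntermediateField.inclusion hKL).toLinearMap
      (IntermediateField.inclusion_injective hKL)
  have hKclosed : IsClosed ((padicCoeffField ι : IntermediateField ℚ_[p] (PadicAlgCl p)) :
      Set (PadicAlgCl p)) :=
    Automorphic.ParallelWeight.isClosed_intermediateField p (padicCoeffField ι)
  have hφK : ∀ y, φ y ∈ padicCoeffField ι := by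
    intro y
    refine Automorphic.ParallelWeight.padicPlaceHom_mem_of_forall_mem _ p j hKclosed (fun x ↦ ?_) y
    rw [SetLike.mem_coe, hjval]
    exact map_mem_padicCoeffField ι _
  have hφint : ∀ y : v.adicCompletionIntegers (coeffCharField (liftToGamma1 M k g)),
      ‖φ (y : v.adicCompletion (coeffCharField (liftToGamma1 M k g)))‖ ≤ 1 := by
    intro y
    have hy : Valued.v (y : v.adicCompletion (coeffCharField (liftToGamma1 M k g))) ≤ 1 :=
      (HeightOneSpectrum.mem_adicCompletionIntegers (𝓞 _) _ _).1 y.2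
    have h1 := Automorphic.ParallelWeight.valued_padicPlaceHom_le_one (coeffCharField (liftToGamma1 M k g)) p j hy
    rwa [PadicAlgCl.valuation_def, ← NNReal.coe_le_coe, coe_nnnorm, NNReal.coe_one] at h1
  -- the continuous ring homomorphism `e : 𝒪_v → 𝒪`
  let φK : v.adicCompletionIntegers (coeffCharField (liftToGamma1 M k g)) →+* padicCoeffField ι :=
    (φ.comp (v.adicCompletionIntegers (coeffCharField (liftToGamma1 M k g))).subtype).codRestrict
      (padicCoeffField ι) fun y ↦ hφK y
  have hφK_val : ∀ y, ((φK y : padicCoeffField ι) : PadicAlgCl p) = φ y := fun _ ↦ rfl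
  let e : v.adicCompletionIntegers (coeffCharField (liftToGamma1 M k g)) →+* padicCoeffIntegers ι :=
    φK.codRestrict (padicCoeffIntegers ι) fun y ↦ by
      rw [mem_padicCoeffIntegers_iff, hφK_val]
      exact hφint y
  have he_val : ∀ y, padicCoeffIntegers.toPadicAlgCl ι (e y) = φ y := fun _ ↦ rfl
  have he : Continuous e := by
    refine continuous_induced_rng.2 (continuous_induced_rng.2 ?_)
    exact hφc.comp continuous_subtype_val
  have heinj : Function.Injective (padicCoeffIntegers.toPadicAlgCl ι) :=
    fun x y hxy ↦ Subtype.ext (Subtype.ext hxy)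
  /- the representation -/
  let ρ : FramedGaloisRep ℚ (padicCoeffIntegers ι) 2 := FramedRep.baseChange e he ρv
  /- (v) filtrations at the places above `p` -/
  have hfil : ∀ w : HeightOneSpectrum (𝓞 ℚ), ((p : ℕ) : 𝓞 ℚ) ∈ w.asIdeal →
      ∃ P : OrdinaryFiltration ρ w, True := by
    intro w hw
    obtain ⟨Q₀, hQ₀⟩ := hframe hw
    obtain ⟨P, -⟩ := OrdinaryFiltration.exists_ofIntegralFrame ρ w
      (Matrix.GeneralLinearGroup.map e Q₀)
      (fun σ ↦ (integralFrame_baseChange e he ρv w Q₀ (fun σ ↦ (hQ₀ σ).1)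
        (fun σ hσ ↦ (hQ₀ σ).2 hσ) σ).1)
      (fun σ hσ ↦ (integralFrame_baseChange e he ρv w Q₀ (fun σ ↦ (hQ₀ σ).1)
        (fun σ hσ ↦ (hQ₀ σ).2 hσ) σ).2 hσ)
    exact ⟨P, trivial⟩
  /- (vi) a uniformiser -/
  obtain ⟨ϖ, hϖlt, hϖdvd⟩ : ∃ ϖ : padicCoeffIntegers ι,
      ‖padicCoeffIntegers.toPadicAlgCl ι ϖ‖ < 1 ∧
      ∀ x : padicCoeffIntegers ι, ‖padicCoeffIntegers.toPadicAlgCl ι x‖ < 1 → ϖ ∣ x := by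
    haveI hdvr := PadicAlgCl.isDiscreteValuationRing_unitBall (padicCoeffField ι)
    obtain ⟨ϖ', hϖ'⟩ := IsDiscreteValuationRing.exists_irreducible
      (Valued.v.comap (algebraMap (padicCoeffField ι) (PadicAlgCl p))).valuationSubring
    have hmax := hϖ'.maximalIdeal_eq
    have hϖ'mem : ((ϖ' : padicCoeffField ι)) ∈ padicCoeffIntegers ι := by
      rw [mem_padicCoeffIntegers_iff]
      exact (PadicAlgCl.mem_unitBall_iff (padicCoeffField ι) _).mp ϖ'.2
    refine ⟨⟨(ϖ' : padicCoeffField ι), hϖ'mem⟩, ?_, fun x hx ↦ ?_⟩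
    · have h1 : ϖ' ∈ IsLocalRing.maximalIdeal _ := by
        rw [hmax]; exact Ideal.mem_span_singleton_self ϖ'
      exact (PadicAlgCl.mem_maximalIdeal_unitBall_iff (padicCoeffField ι) ϖ').mp h1
    · -- `x`, read in the valuation ring, lies in the maximal ideal `(ϖ')`
      have hxmem : (x : padicCoeffField ι) ∈
          (Valued.v.comap (algebraMap (padicCoeffField ι) (PadicAlgCl p))).valuationSubring :=
        (PadicAlgCl.mem_unitBall_iff (padicCoeffField ι) _).mpr
          ((mem_padicCoeffIntegers_iff ι _).mp x.2)
      have hx' : (⟨(x : padicCoeffField ι), hxmem⟩ :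
          (Valued.v.comap (algebraMap (padicCoeffField ι) (PadicAlgCl p))).valuationSubring) ∈
          IsLocalRing.maximalIdeal _ :=
        (PadicAlgCl.mem_maximalIdeal_unitBall_iff (padicCoeffField ι) _).mpr hx
      rw [hmax, Ideal.mem_span_singleton] at hx'
      obtain ⟨c, hc⟩ := hx'
      have hcmem : (c : padicCoeffField ι) ∈ padicCoeffIntegers ι := by
        rw [mem_padicCoeffIntegers_iff]
        exact (PadicAlgCl.mem_unitBall_iff (padicCoeffField ι) _).mp c.2
      refine ⟨⟨(c : padicCoeffField ι), hcmem⟩, Subtype.ext ?_⟩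
      change (x : padicCoeffField ι) = (ϖ' : padicCoeffField ι) * (c : padicCoeffField ι)
      exact congrArg (fun z :
        (Valued.v.comap (algebraMap (padicCoeffField ι) (PadicAlgCl p))).valuationSubring ↦
          (z : padicCoeffField ι)) hc
  /- (iv) attached to `(g, ι)` away from `M p`, and assembly -/
  refine ⟨{ ρ := ρ
            charpoly := ?_
            fil := fun w hw ↦ (hfil w hw).choose
            ϖ := ϖ
            norm_ϖ_lt_one := hϖlt
            dvd_of_norm_lt_one := hϖdvd }⟩
  intro v' hℓM hℓp
  have hℓprime : ((primesEquiv v' : Nat.Primes) : ℕ).Prime := (primesEquiv v').2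
  have hv'S : ((primesEquiv v' : Nat.Primes) : ℕ) ∉ {q | q ∣ M * p} := by
    intro hdvd
    rcases (Nat.Prime.dvd_mul hℓprime).mp hdvd with h1 | h1
    · exact hℓM h1
    · exact hℓp ((Nat.prime_dvd_prime_iff_eq hℓprime hp).mp h1)
  obtain ⟨hur, hchar⟩ := hρv v' hv'S
  -- unramified
  have hurv : ρv.IsUnramifiedAt v' :=
    isUnramifiedAt_of_baseChange_injective _ continuous_subtype_val Subtype.val_injective hur
  refine ⟨isUnramifiedAt_baseChange e he hurv, ?_⟩
  -- the Frobenius polynomial: the image in `ℚ̄_p[X]` of `charpoly ρ(σ)` is `X² − ι(a_ℓ)X + ℓ^{k-1}`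
  have hsq : ∀ y : v.adicCompletionIntegers (coeffCharField (liftToGamma1 M k g)),
      padicCoeffIntegers.toPadicAlgCl ι (e y) =
        φ ((v.adicCompletionIntegers (coeffCharField (liftToGamma1 M k g))).subtype y) :=
    fun _ ↦ rfl
  have htarget : ∀ σ : absoluteGaloisGroup ℚ, (∃ 𝔓 ∈ v'.primesAbove, IsArithFrobAt (𝓞 ℚ) σ 𝔓) →
      (FramedRep.charpoly ρ σ).map (padicCoeffIntegers.toPadicAlgCl ι) =
        X ^ 2 - C (ι ⟨(qExpansion 1 ⇑g).coeff ((primesEquiv v' : Nat.Primes) : ℕ),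
          coeff_mem_coeffField g _⟩) * X +
          C ((((primesEquiv v' : Nat.Primes) : ℕ) : PadicAlgCl p) ^ (k - 1).toNat) := by
    rintro σ ⟨𝔓, h𝔓, hσ⟩
    rw [map_charpoly_baseChange_eq e he _ continuous_subtype_val
      (padicCoeffIntegers.toPadicAlgCl ι) φ hsq ρv σ, hchar 𝔓 h𝔓 σ hσ, Polynomial.map_map,
      show φ.comp (algebraMap (coeffCharField (liftToGamma1 M k g))
        (v.adicCompletion (coeffCharField (liftToGamma1 M k g)))) = j from RingHom.ext hφj,
      map_heckePolynomial_of_nebentypus_eq_one hε (by omega)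
        ((Nat.Prime.coprime_iff_not_dvd hℓprime).mpr hℓM) j, hjn]
  -- choose one arithmetic Frobenius to name `P`
  obtain ⟨𝔓₀, h𝔓₀⟩ := v'.primesAbove_nonempty
  obtain ⟨σ₀, hσ₀⟩ := HeightOneSpectrum.exists_isArithFrobAt_of_mem_primesAbove_holds h𝔓₀
  refine ⟨FramedRep.charpoly ρ σ₀, htarget σ₀ ⟨𝔓₀, h𝔓₀, hσ₀⟩, fun 𝔓 h𝔓 σ hσ ↦ ?_⟩
  apply Polynomial.map_injective (padicCoeffIntegers.toPadicAlgCl ι) heinj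
  rw [htarget σ ⟨𝔓, h𝔓, hσ⟩, htarget σ₀ ⟨𝔓₀, h𝔓₀, hσ₀⟩]

end GammaZero

end Literature.NumberTheory.EllipticCurves.GreenbergSelmer

end
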